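import Literature.NumberTheory.LFunctions.WeilFirstPrimeCells
import HarnessLib

/-!
# Data-driven cells for the first-prime Weil weight

The variant `FPDCell` of the cells `FPCell` of `WeilFirstPrimeCells.lean` (weight
`w₂(t) = Re ψ(1/4 + it/2) − √2 log 2 cos(t log 2)`): the constants `Llo ≤ log 2 ≤ Lhi`,
`alo ≤ α(u) = −√2 log 2 cos(u log 2)`, `blo ≤ β(u) = √2 log 2 sin(u log 2)` are CLAIMED by the
certificate data and only CHECKED against the engine values (`logTwoLoQ/HiQ`, `alphaLoQ`,
`betaLoQ`), so that the ripple polynomial and the exact moments are functions of the data alone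
(a generator then needs no replica of the fixed-point engine). Soundness `FPDCell.sigma_le`
(`σ ≤ w₂` on the cell), `FPDCell.sigma_le_level`, exact moments `FPDCell.momentQ`
(`FPDCell.integral_level_sub_sigma_mul_pow`). Everything here is proved; no named facts.

## References

* H. Yoshida, *On Hermitian forms attached to zeta functions*, Adv. Stud. Pure Math. 21 (1992), §6.
* R. E. Moore, *Interval Analysis* (1966), Ch. 3.
-/

noncomputable section

open Complex Finset MeasureTheory Set Filter
open scoped Real Topology BigOperators

namespace Literature.NumberTheory.LFunctions

open Literature.Analysis.ValidatedNumerics.Numerics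

/-! ## First-prime cells with claimed (data) constants -/

/-- A DATA-DRIVEN cell of a certified minorant of `w₂`: a digamma cell `psi` (for
`Re ψ(1/4 + it/2)` on `[u, v]`), the truncation order `n ≥ 1` of the trigonometric brackets, and
CLAIMED rationals `Llo ≤ log 2 ≤ Lhi`, `alo ≤ α(u)`, `blo ≤ β(u)` which the checker verifies against
the engine (`logTwoLoQ/HiQ`, `alphaLoQ`, `betaLoQ`); the ripple polynomial (`FPDCell.cosPart`) is then an
exact function of the data, so that a certificate generator need not replicate the engine (variant
of `FPCell`, whose constants are engine-computed). [folklore] -/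
structure FPDCell where
  /-- the digamma cell on `[u, v]` -/
  psi : WeilCell
  /-- order of the Maclaurin brackets of `cos(hL)`, `sin(hL)`, `h = t − u` -/
  n : ℕ
  /-- claimed rational lower end for `log 2` (checked: `Llo ≤ logTwoLoQ`, `0 ≤ Llo`) -/
  Llo : ℚ
  /-- claimed rational upper end for `log 2` (checked: `logTwoHiQ ≤ Lhi`) -/
  Lhi : ℚ
  /-- claimed lower bound of `α(u) = −√2 log 2 cos(u log 2)` (checked: `alo ≤ alphaLoQ u`) -/
  alo : ℚ
  /-- claimed lower bound of `β(u) = √2 log 2 sin(u log 2)` (checked: `blo ≤ betaLoQ u`) -/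
  blo : ℚ

namespace FPDCell

variable (c : FPDCell)

/-- The bracket of `cos(hL)` used with the sign of `alphaLoQ`: lower if `α_lo ≥ 0`, upper otherwise. [folklore] -/
def cosBracket : List ℚ :=
  if 0 ≤ c.alo then cosLoCoeffs c.Llo c.Lhi c.n else cosUpCoeffs c.Llo c.Lhi c.n

/-- The bracket of `sin(hL)` used with the sign of `betaLoQ`. [folklore] -/
def sinBracket : List ℚ :=
  if 0 ≤ c.blo then sinLoCoeffs c.Llo c.Lhi c.n else sinUpCoeffs c.Llo c.Lhi c.n

/-- The ripple polynomial of the cell: coefficients of `h^k`, `h = t − u`, of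
`α_lo · (cos bracket) + β_lo · (sin bracket)`, a lower bound of `−√2 log 2 cos(t log 2)`. [folklore] -/
def cosPart : List ℚ :=
  tabV (c.n + 1) fun k ↦ c.alo * getV c.cosBracket k + c.blo * getV c.sinBracket k

/-- The cell polynomial `σ(t) = σ_ψ(t) + P(t − u)`. [folklore] -/
def sigma (t : ℝ) : ℝ := c.psi.sigma t + polyR c.cosPart (t - c.psi.u)

/-- `Σ_k |p_k| (v − u)^k`, an upper bound of `|P|` on the cell. [folklore] -/
def absPartQ : ℚ := sumR (c.n + 1) fun k ↦ |getV c.cosPart k| * (c.psi.v - c.psi.u) ^ k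

/-- All checks of a first-prime cell: the digamma cell is checked (with its own level test
neutralised), `n ≥ 1`, `0 ≤ Llo`, `(v − u) · Lhi ≤ 1` (so `0 ≤ hL ≤ 1` on the cell), and the claimed
constants are verified against the engine. (No level test: the certificate works with a SIGNED
`γ = wL − σ`, see `FPDCell.abs_level_sub_sigma_le`.) [folklore] -/
def check (p : ℕ) : Bool :=
  c.psi.check p c.psi.posPartQ && decide (0 < c.n) && decide (0 ≤ c.Llo) &&
    decide ((c.psi.v - c.psi.u) * c.Lhi ≤ 1) &&
    decide (c.Llo ≤ logTwoLoQ) && decide (logTwoHiQ ≤ c.Lhi) &&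
    decide (c.alo ≤ alphaLoQ c.psi.u) && decide (c.blo ≤ betaLoQ c.psi.u)

variable {c} {p : ℕ}

/-- Unpacking `check`. [folklore] -/
theorem check_spec (h : c.check p = true) :
    c.psi.check p c.psi.posPartQ = true ∧ 0 < c.n ∧ 0 ≤ c.Llo ∧
      (c.psi.v - c.psi.u) * c.Lhi ≤ 1 ∧
      c.Llo ≤ logTwoLoQ ∧ logTwoHiQ ≤ c.Lhi ∧ c.alo ≤ alphaLoQ c.psi.u ∧ c.blo ≤ betaLoQ c.psi.u := by
  simp only [check, Bool.and_eq_true, decide_eq_true_eq] at h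
  exact ⟨h.1.1.1.1.1.1.1, h.1.1.1.1.1.1.2, h.1.1.1.1.1.2, h.1.1.1.1.2, h.1.1.1.2, h.1.1.2, h.1.2, h.2⟩

/-- A checked cell has `0 ≤ u`. [folklore] -/
theorem u_nonneg (h : c.check p = true) : 0 ≤ c.psi.u :=
  WeilCell.u_nonneg (check_spec h).1

/-- A checked cell has `u < v`. [folklore] -/
theorem u_lt_v (h : c.check p = true) : c.psi.u < c.psi.v :=
  WeilCell.u_lt_v (check_spec h).1

/-- Lengths of the brackets. [folklore] -/
theorem length_cosBracket (c : FPDCell) : c.cosBracket.length = c.n + 1 := by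
  unfold cosBracket cosLoCoeffs cosUpCoeffs; split_ifs <;> simp [tabV]

/-- Lengths of the brackets. [folklore] -/
theorem length_sinBracket (c : FPDCell) : c.sinBracket.length = c.n + 1 := by
  unfold sinBracket sinLoCoeffs sinUpCoeffs; split_ifs <;> simp [tabV]

/-- `P(h) = α_lo · (cos bracket)(h) + β_lo · (sin bracket)(h)`. [folklore] -/
theorem polyR_cosPart (c : FPDCell) (h : ℝ) :
    polyR c.cosPart h = (c.alo : ℝ) * polyR c.cosBracket h + (c.blo : ℝ) * polyR c.sinBracket h := by
  unfold cosPart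
  rw [polyR_tabV]
  unfold polyR
  rw [length_cosBracket, length_sinBracket, Finset.mul_sum, Finset.mul_sum, ← Finset.sum_add_distrib]
  refine Finset.sum_congr rfl fun k _ ↦ ?_
  push_cast
  ring

/-- **Ripple soundness.** On the cell, `P(t − u) ≤ −√2 log 2 cos(t log 2)`. [folklore] -/
theorem polyR_cosPart_le (h : c.check p = true) {t : ℝ} (hut : (c.psi.u : ℝ) ≤ t)
    (htv : t ≤ (c.psi.v : ℝ)) :
    polyR c.cosPart (t - c.psi.u) ≤ -(Real.sqrt 2 * Real.log 2 * Real.cos (t * Real.log 2)) := by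
  obtain ⟨-, hn, hL0q, hwq, hLloq, hLhiq, haloq, hbloq⟩ := check_spec h
  set L : ℝ := Real.log 2 with hLdef
  set u : ℝ := (c.psi.u : ℝ) with hudef
  set hh : ℝ := t - u with hhdef
  have hL0 : (0 : ℝ) ≤ c.Llo := by exact_mod_cast hL0q
  have hL1 : (c.Llo : ℝ) ≤ L := le_trans (by exact_mod_cast hLloq) logTwo_mem_Q.1
  have hL2 : L ≤ (c.Lhi : ℝ) := le_trans logTwo_mem_Q.2 (by exact_mod_cast hLhiq)
  have hLnn : 0 ≤ L := hL0.trans hL1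
  have hh0 : 0 ≤ hh := by rw [hhdef]; linarith
  have hhw : hh ≤ (c.psi.v : ℝ) - c.psi.u := by rw [hhdef, hudef]; linarith
  have hhL : hh * L ≤ 1 := by
    have h1 : hh * L ≤ ((c.psi.v : ℝ) - c.psi.u) * c.Lhi :=
      mul_le_mul hhw hL2 hLnn (by linarith)
    have h2 : ((c.psi.v : ℝ) - c.psi.u) * c.Lhi ≤ 1 := by exact_mod_cast hwq
    linarith
  have hy0 : 0 ≤ hh * L := mul_nonneg hh0 hLnn
  have hcos0 : 0 ≤ Real.cos (hh * L) :=
    Real.cos_nonneg_of_mem_Icc ⟨by linarith [Real.pi_pos], by linarith [Real.pi_gt_three]⟩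
  have hsin0 : 0 ≤ Real.sin (hh * L) :=
    Real.sin_nonneg_of_nonneg_of_le_pi hy0 (by linarith [Real.pi_gt_three])
  -- addition formula at the left end point
  set α : ℝ := -(Real.sqrt 2 * Real.log 2 * Real.cos (u * L)) with hαdef
  set β : ℝ := Real.sqrt 2 * Real.log 2 * Real.sin (u * L) with hβdef
  have hadd : -(Real.sqrt 2 * Real.log 2 * Real.cos (t * Real.log 2)) =
      α * Real.cos (hh * L) + β * Real.sin (hh * L) := by
    have : t * Real.log 2 = u * L + hh * L := by rw [hhdef, hLdef]; ring
    rw [this, Real.cos_add, hαdef, hβdef]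
    ring
  have ha : (c.alo : ℝ) ≤ α := by
    rw [hαdef, hudef, hLdef]; exact le_trans (by exact_mod_cast haloq) (alphaLoQ_le c.psi.u)
  have hb : (c.blo : ℝ) ≤ β := by
    rw [hβdef, hudef, hLdef]; exact le_trans (by exact_mod_cast hbloq) (betaLoQ_le c.psi.u)
  rw [hadd, polyR_cosPart]
  refine add_le_add ?_ ?_
  · unfold cosBracket
    split_ifs with hsgn
    · have h0 : (0 : ℝ) ≤ c.alo := by exact_mod_cast hsgn
      calc (c.alo : ℝ) * polyR (cosLoCoeffs c.Llo c.Lhi c.n) hh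
          ≤ (c.alo : ℝ) * Real.cos (hh * L) :=
            mul_le_mul_of_nonneg_left (polyR_cosLo_le hL0 hL1 hL2 hh0 hhL hn) h0
        _ ≤ α * Real.cos (hh * L) := mul_le_mul_of_nonneg_right ha hcos0
    · push Not at hsgn
      have h0 : (c.alo : ℝ) ≤ 0 := by exact_mod_cast hsgn.le
      calc (c.alo : ℝ) * polyR (cosUpCoeffs c.Llo c.Lhi c.n) hh
          ≤ (c.alo : ℝ) * Real.cos (hh * L) :=
            mul_le_mul_of_nonpos_left (cos_le_polyR_cosUp hL0 hL1 hL2 hh0 hhL hn) h0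
        _ ≤ α * Real.cos (hh * L) := mul_le_mul_of_nonneg_right ha hcos0
  · unfold sinBracket
    split_ifs with hsgn
    · have h0 : (0 : ℝ) ≤ c.blo := by exact_mod_cast hsgn
      calc (c.blo : ℝ) * polyR (sinLoCoeffs c.Llo c.Lhi c.n) hh
          ≤ (c.blo : ℝ) * Real.sin (hh * L) :=
            mul_le_mul_of_nonneg_left (polyR_sinLo_le hL0 hL1 hL2 hh0 hhL hn) h0
        _ ≤ β * Real.sin (hh * L) := mul_le_mul_of_nonneg_right hb hsin0
    · push Not at hsgn
      have h0 : (c.blo : ℝ) ≤ 0 := by exact_mod_cast hsgn.le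
      calc (c.blo : ℝ) * polyR (sinUpCoeffs c.Llo c.Lhi c.n) hh
          ≤ (c.blo : ℝ) * Real.sin (hh * L) :=
            mul_le_mul_of_nonpos_left (sin_le_polyR_sinUp hL0 hL1 hL2 hh0 hhL hn) h0
        _ ≤ β * Real.sin (hh * L) := mul_le_mul_of_nonneg_right hb hsin0

/-- **Cell soundness.** On its cell, `σ(t) ≤ Re ψ(1/4 + it/2) − √2 log 2 cos(t log 2) = w₂(t)`. [folklore] -/
theorem sigma_le (h : c.check p = true) {t : ℝ} (hut : (c.psi.u : ℝ) ≤ t) (htv : t ≤ (c.psi.v : ℝ)) :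
    c.sigma t ≤ Literature.Analysis.SpecialFunctions.reDigammaQuarter t -
      Real.sqrt 2 * Real.log 2 * Real.cos (t * Real.log 2) := by
  have h1 := WeilCell.sigma_le (check_spec h).1 hut htv
  have h2 := polyR_cosPart_le h hut htv
  unfold sigma
  linarith

/-- Cast of `absPartQ`. [folklore] -/
theorem absPartQ_cast (c : FPDCell) :
    ((c.absPartQ : ℚ) : ℝ) = ∑ k ∈ Finset.range (c.n + 1),
      |((getV c.cosPart k : ℚ) : ℝ)| * ((c.psi.v : ℝ) - c.psi.u) ^ k := by
  unfold absPartQ; rw [sumR_eq_sum]; push_cast; rfl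

/-- `Σ_k |c_k| (v² − u²)^{k+1}`, a bound for the digamma-cell increment `|σ_ψ − W|`. [folklore] -/
def psiAbsIncQ : ℚ :=
  sumR c.psi.c.length fun k ↦ |c.psi.coeff k| * (c.psi.v * c.psi.v - c.psi.u * c.psi.u) ^ (k + 1)

/-- A bound for `|wL − σ|` on the cell: `|wL − W| + Σ_k |c_k|(v²−u²)^{k+1} + Σ_k |p_k|(v−u)^k`. [folklore] -/
def bndQ (wL : ℚ) : ℚ := |wL - c.psi.W| + c.psiAbsIncQ + c.absPartQ

/-- `|σ_ψ(t) − W| ≤ Σ |c_k| (v² − u²)^{k+1}` on the cell. [folklore] -/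
theorem abs_psi_sigma_sub_W_le (h : c.check p = true) {t : ℝ} (hut : (c.psi.u : ℝ) ≤ t)
    (htv : t ≤ (c.psi.v : ℝ)) : |c.psi.sigma t - c.psi.W| ≤ c.psiAbsIncQ := by
  have hu : (0 : ℝ) ≤ c.psi.u := by exact_mod_cast u_nonneg h
  have hs0 : 0 ≤ t ^ 2 - (c.psi.u : ℝ) ^ 2 := by nlinarith
  have hsmax : t ^ 2 - (c.psi.u : ℝ) ^ 2 ≤ (c.psi.v : ℝ) * c.psi.v - (c.psi.u : ℝ) * c.psi.u := by nlinarith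
  unfold WeilCell.sigma psiAbsIncQ
  rw [add_sub_cancel_left, sumR_eq_sum]
  push_cast
  refine (Finset.abs_sum_le_sum_abs _ _).trans (Finset.sum_le_sum fun k _ ↦ ?_)
  rw [abs_mul, abs_pow, abs_of_nonneg hs0]
  exact mul_le_mul_of_nonneg_left (pow_le_pow_left₀ hs0 hsmax _) (abs_nonneg _)

/-- **Signed-`γ` control.** On its cell, `|wL − σ(t)| ≤ bndQ wL`. [folklore] -/
theorem abs_level_sub_sigma_le (h : c.check p = true) (wL : ℚ) {t : ℝ} (hut : (c.psi.u : ℝ) ≤ t)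
    (htv : t ≤ (c.psi.v : ℝ)) : |(wL : ℝ) - c.sigma t| ≤ c.bndQ wL := by
  have h1 := abs_psi_sigma_sub_W_le h hut htv
  have hlen : c.cosPart.length = c.n + 1 := by simp [cosPart, tabV]
  have h2 := abs_polyR_le c.cosPart (h := t - c.psi.u) (w := (c.psi.v : ℝ) - c.psi.u)
    (by linarith) (by linarith)
  rw [hlen, ← absPartQ_cast] at h2
  unfold sigma bndQ
  push_cast
  have e : (wL : ℝ) - (c.psi.sigma t + polyR c.cosPart (t - c.psi.u)) =
      ((wL : ℝ) - c.psi.W) - (c.psi.sigma t - c.psi.W) - polyR c.cosPart (t - c.psi.u) := by ring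
  rw [e]
  refine (abs_sub _ _).trans (add_le_add ((abs_sub _ _).trans (add_le_add le_rfl h1)) h2)

/-- `0 ≤ bndQ` for a checked cell. [folklore] -/
theorem bndQ_nonneg (h : c.check p = true) (wL : ℚ) : 0 ≤ c.bndQ wL := by
  have hu : 0 ≤ c.psi.u := u_nonneg h
  have huv : c.psi.u < c.psi.v := u_lt_v h
  have h1 : 0 ≤ c.psi.v * c.psi.v - c.psi.u * c.psi.u := by nlinarith
  have h2 : 0 ≤ c.psi.v - c.psi.u := by linarith
  unfold bndQ psiAbsIncQ absPartQ
  rw [sumR_eq_sum, sumR_eq_sum]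
  exact add_nonneg (add_nonneg (abs_nonneg _)
    (Finset.sum_nonneg fun k _ ↦ mul_nonneg (abs_nonneg _) (pow_nonneg h1 _)))
    (Finset.sum_nonneg fun k _ ↦ mul_nonneg (abs_nonneg _) (pow_nonneg h2 _))

/-- Continuity of the cell polynomial. [folklore] -/
theorem continuous_sigma (c : FPDCell) : Continuous c.sigma := by
  unfold sigma polyR
  exact c.psi.continuous_sigma.add (continuous_finsetSum _ fun k _ ↦ by fun_prop)

/-! ### Exact moments of a first-prime cell -/

/-- `∫_u^v (s − u)^k s^q ds` in closed form: `Σ_i C(k,i) (−u)^{k−i} (v^{i+q+1} − u^{i+q+1})/(i+q+1)`. [folklore] -/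
def shiftPowIntQ (c : FPDCell) (k q : ℕ) : ℚ :=
  sumR (k + 1) fun i ↦ ((k.choose i : ℕ) : ℚ) * (-c.psi.u) ^ (k - i) * c.psi.powIntQ (i + q + 1)

/-- `∫_u^v (wL − σ(s)) s^q ds` in closed form. [folklore] -/
def momentQ (wL : ℚ) (c : FPDCell) (q : ℕ) : ℚ :=
  c.psi.momentQ wL q - sumR (c.n + 1) fun k ↦ getV c.cosPart k * c.shiftPowIntQ k q

/-- `∫_u^v (s − u)^k s^q ds = shiftPowIntQ`. [folklore] -/
theorem integral_shift_pow_mul_pow (c : FPDCell) (k q : ℕ) :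
    ∫ s in (c.psi.u : ℝ)..c.psi.v, (s - c.psi.u) ^ k * s ^ q = (c.shiftPowIntQ k q : ℝ) := by
  have hexp : ∀ s : ℝ, (s - c.psi.u) ^ k * s ^ q =
      ∑ i ∈ Finset.range (k + 1), ((k.choose i : ℕ) : ℝ) * (-(c.psi.u : ℝ)) ^ (k - i) * s ^ (i + q) := by
    intro s
    rw [sub_eq_add_neg, add_pow, Finset.sum_mul]
    refine Finset.sum_congr rfl fun i _ ↦ ?_
    rw [pow_add]; ring
  simp_rw [hexp]
  rw [intervalIntegral.integral_finsetSum
    (f := fun i s ↦ ((k.choose i : ℕ) : ℝ) * (-(c.psi.u : ℝ)) ^ (k - i) * s ^ (i + q))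
    (fun i _ ↦ (by fun_prop : Continuous fun s : ℝ ↦
      ((k.choose i : ℕ) : ℝ) * (-(c.psi.u : ℝ)) ^ (k - i) * s ^ (i + q)).intervalIntegrable _ _)]
  unfold shiftPowIntQ
  rw [sumR_eq_sum]
  push_cast
  refine Finset.sum_congr rfl fun i _ ↦ ?_
  rw [intervalIntegral.integral_const_mul, WeilCell.integral_pow_eq_powIntQ]

/-- **Cell moments.** `∫_u^v (wL − σ(s)) s^q ds = momentQ`. [folklore] -/
theorem integral_level_sub_sigma_mul_pow (wL : ℚ) (c : FPDCell) (q : ℕ) :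
    ∫ s in (c.psi.u : ℝ)..c.psi.v, ((wL : ℝ) - c.sigma s) * s ^ q = (c.momentQ wL q : ℝ) := by
  have hlen : c.cosPart.length = c.n + 1 := by simp [cosPart, tabV]
  have hpt : ∀ s : ℝ, ((wL : ℝ) - c.sigma s) * s ^ q =
      ((wL : ℝ) - c.psi.sigma s) * s ^ q -
        ∑ k ∈ Finset.range (c.n + 1), ((getV c.cosPart k : ℚ) : ℝ) * ((s - c.psi.u) ^ k * s ^ q) := by
    intro s
    unfold sigma polyR
    rw [hlen]
    have : (∑ k ∈ Finset.range (c.n + 1), ((getV c.cosPart k : ℚ) : ℝ) * (s - c.psi.u) ^ k) * s ^ q =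
        ∑ k ∈ Finset.range (c.n + 1), ((getV c.cosPart k : ℚ) : ℝ) * ((s - c.psi.u) ^ k * s ^ q) := by
      rw [Finset.sum_mul]
      exact Finset.sum_congr rfl fun k _ ↦ by ring
    rw [show ((wL : ℝ) - (c.psi.sigma s + ∑ k ∈ Finset.range (c.n + 1),
        ((getV c.cosPart k : ℚ) : ℝ) * (s - c.psi.u) ^ k)) * s ^ q =
        ((wL : ℝ) - c.psi.sigma s) * s ^ q - (∑ k ∈ Finset.range (c.n + 1),
        ((getV c.cosPart k : ℚ) : ℝ) * (s - c.psi.u) ^ k) * s ^ q by ring, this]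
  simp_rw [hpt]
  have i0 : IntervalIntegrable (fun s ↦ ((wL : ℝ) - c.psi.sigma s) * s ^ q) volume c.psi.u c.psi.v :=
    ((continuous_const.sub c.psi.continuous_sigma).mul (continuous_pow q)).intervalIntegrable _ _
  have iK : ∀ k, IntervalIntegrable
      (fun s : ℝ ↦ ((getV c.cosPart k : ℚ) : ℝ) * ((s - c.psi.u) ^ k * s ^ q)) volume c.psi.u c.psi.v :=
    fun k ↦ (continuous_const.mul ((continuous_pow k |>.comp (continuous_sub_right _)).mul
      (continuous_pow q))).intervalIntegrable _ _
  have iS : IntervalIntegrable (fun s : ℝ ↦ ∑ k ∈ Finset.range (c.n + 1),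
      ((getV c.cosPart k : ℚ) : ℝ) * ((s - c.psi.u) ^ k * s ^ q)) volume c.psi.u c.psi.v :=
    (continuous_finsetSum _ fun k _ ↦ (continuous_const.mul ((continuous_pow k |>.comp
      (continuous_sub_right _)).mul (continuous_pow q)))).intervalIntegrable _ _
  rw [intervalIntegral.integral_sub i0 iS, WeilCell.integral_level_sub_sigma_mul_pow,
    intervalIntegral.integral_finsetSum fun k _ ↦ iK k]
  unfold momentQ
  rw [sumR_eq_sum]
  push_cast
  congr 1
  refine Finset.sum_congr rfl fun k _ ↦ ?_
  rw [intervalIntegral.integral_const_mul, integral_shift_pow_mul_pow]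

end FPDCell

end Literature.NumberTheory.LFunctions
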